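import Summits.HodgeConjecture.HodgeConjecture.Theorems.H413SpectrumInterfacesKernel
import Literature.NumberTheory.Automorphic.HeckeRelatedOfIntertwiner
import Literature.NumberTheory.Automorphic.UnitaryGroupCohomologicalFormsSmooth
import HarnessLib

/-!
# Crux `H413`, line `F0_P2CohSpectrumL2` — the ENGINE SOCKET `E2E2b` REDUCED TO A THETA-EMBEDDING STATEMENT
# (programme P2's pin bridge, Hecke half + smoothness half, over ★ `H413SpectrumInterfaces` ∕ `…Kernel`)

HC_CM is proved only modulo the 7 printed citations until rung 0 closes.

F0P2-p02 (g0), 2026-08-30 (F0P2-plan (g0) PLAN §5 «E2PinBridge», 21:29:33Z / 21:59:15Z).  PROOF FILE (theorems only, no `def`, no `sorry`)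
for crux item `stmt-HodgeConjecture-24833`, stub `stub_E2E2b_cotPartSpectrumIsTheta : StubE2E2bCotPartSpectrumIsTheta` of the registered cut
`Cruxes/H413/Lines/F0_P2CohSpectrumL2.lean` (b83be9972fd1fff6 :542; TYPE ★ `SpectrumInterfaces.StubE2E2bCotPartSpectrumIsTheta`).

WHAT IS PROVED.  The stub says: at `n = 3`, every irreducible `σ` of `U(V)(𝔸_{F⁺,f})` occurring in the cotangent part `cotPart 𝔞₀ μ ℓ Π` of a discrete
automorphic `Π` admits a compact open `K` and a weight-one triple `t` with `ε` global such that `σ` and `ω_t = rhoTriple (datum413 …) t` are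
HECKE-RELATED at level `K` (`HeckeRelatedAt`).  The engine letters ((C) ★ `Rogawski1990.cohFinComponent_isTheta` + the junction J0–J3 + the line-class
transport) deliver something of a different shape: an INJECTIVE INTERTWINER `σ ↪ ω_t` for an irreducible SMOOTH `σ`.  This file closes the gap between the
two shapes once and for all:
* §1 `exists_heckeRelatedAt_of_injective` — for any [Liu2021, 4.13]-datum `P` whose group has a compact open subgroup: an injective intertwiner out of an
  irreducible smooth `σ` gives `∃ K, IsOpen K ∧ IsCompact K ∧ HeckeRelatedAt K σ σ'` (★ `Literature…exists_heckeRelated_of_intertwiningMap`, the `∃`-body of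
  `HeckeRelatedAt` being that lemma's conclusion token for token; [BushnellHenniart2006, §4.2–4.3]);
* §2 `spectrumIsThetaAtLevel_of_embeds` — `SpectrumIsThetaAtLevel P R A` follows from (a) «irreducibles occurring in `A` are smooth» and (b) the
  THETA-EMBEDDING statement «`P.n = 3 →` every irreducible smooth `σ` occurring in `A` embeds into some `rhoTriple P t`, `t` weight-one, `t.ε` global»;
* §3 at the carriers: `exists_isCompact_isOpen_subgroup_adelicFin` (★ `UnitaryGroup.finAdelicIntegralLevel`), `isSmooth_of_equivariant_into_cohForms`
  (★ `Literature…CotangentForms.isSmooth_of_equivariant_of_le_smoothFun` + `cohForms_le_smoothFun`; the crux carriers ARE the Literature carriers by `rfl`);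
* §4 THE PIN: **`stubE2E2b_of_embeds`** — `StubE2E2bCotPartSpectrumIsTheta` follows from the theta-embedding statement for the cotangent parts
  `cotPart F V (archFactorOf F V) μ ℓ π` at every face (hypothesis `hE`, displayed in the theorem; it is what (C) + J0–J3 + the line-class transport of
  `ω(μ, ε_a, χ)_f` assemble to — F0P2-plan's «E2Letter ∧ E2Junction ∧ E2PinBridge»), with smoothness (a) DISCHARGED here (`cotPart ≤ cohForms ≤ smoothFun`).

Sources: [Liu2021, proof of Prop. 4.13 l. 2131–2146; Rem. 4.14; Def. 4.11]; [BushnellHenniart2006, §4.2–4.3]; [BorelJacquet1979, §4.2, §4.6];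
[BernsteinZelevinsky1976, §2.1]; [Rogawski1990, Thm. 13.3.6 (c)]; [GelbartRogawski1991, Thm. 5.1.1, Lem. 5.1.2].
-/

set_option autoImplicit false

-- the mandated namespace has the single-problem summit's repeated segment (`HodgeConjecture.HodgeConjecture`), as in every `Cruxes/…` module of this sub-problem
set_option linter.dupNamespace false

noncomputable section

namespace Summit.HodgeConjecture.HodgeConjecture.Cruxes.H413.E2PinBridge

open scoped TensorProduct Matrix
open NumberField NumberField.InfinitePlace IsDedekindDomain
open HodgeCM.Model HodgeCM.Model.LiuIndex HodgeCM.Model.TowerCarrier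
open Summit.HodgeConjecture.CorCM.Model
open Literature.AlgebraicGeometry.Motives (CMType AbelianVariety)
open Literature.AlgebraicGeometry.HodgeTheory Literature.NumberTheory.Automorphic.PicardCM
open Literature.AlgebraicGeometry.ShimuraVarieties Literature.AlgebraicGeometry.ShimuraVarieties.UnitaryCanonicalModel
open Literature.NumberTheory.ComplexMultiplication
open Literature.NumberTheory.Automorphic
open Literature.NumberTheory.Automorphic.Liu2021 Literature.NumberTheory.Automorphic.Liu2021.AppendixC
open Literature.NumberTheory.GelbartRogawski1991 Literature.NumberTheory.GelbartRogawski1991.UnitaryDualPair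
open Literature.RepresentationTheory Literature.RepresentationTheory.Liu2021
open Summit.HodgeConjecture.CorCM
open Summit.HodgeConjecture.CorCM.Transposition
open Literature.NumberTheory.GelbartRogawski1991.OscillatorTripleDictionary (OccursInH1 IsIsoToOmega rhoTriple)
open MulAction
open Literature.Geometry.ComplexHyperbolic.BallModel (U21 x₀)
open Summit.HodgeConjecture.CorCM.Lines.A3Liu413 (datum413)
open Summit.HodgeConjecture.HodgeConjecture.Cruxes.H413.CohFormsCarriers
open Summit.HodgeConjecture.HodgeConjecture.Cruxes.H413.SpectrumInterfaces

/-! ## §1–§2  Generic over a [Liu2021, Prop. 4.13] datum `P` -/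

section Generic

variable {F₀ E₀ : Type} [Field F₀] [NumberField F₀] [IsTotallyReal F₀] [Field E₀] [NumberField E₀] [Algebra F₀ E₀]
  [IsTotallyComplex E₀] [Algebra.IsQuadraticExtension F₀ E₀]

/-- **An injective intertwiner out of an irreducible smooth `σ` makes `σ` and `σ'` HECKE-RELATED at some compact open level** (`HeckeRelatedAt`, by name),
for any datum `P` whose group `P.G` has a compact open subgroup `K₀`: the level is `K₀ ∩ Stab(w)` for a non-zero `w ∈ σ`, the relating map is the intertwiner
itself (it maps `σ^K` to `σ'^K`, commutes with every `[KgK]` — finite sums of translates with the same representatives — and is non-zero on `σ^K ∋ w`).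
★ `Literature.NumberTheory.Automorphic.exists_heckeRelated_of_intertwiningMap`. [cite: BushnellHenniart2006, §4.2–4.3] [cite: BernsteinZelevinsky1976, §2.1] -/
theorem exists_heckeRelatedAt_of_injective (P : Prop413Data F₀ E₀) (K₀ : Subgroup P.G) (hK₀c : IsCompact (K₀ : Set P.G))
    (hK₀o : IsOpen (K₀ : Set P.G)) {W : Type} [AddCommGroup W] [Module ℂ W] (σ : Representation ℂ P.G W) (hirr : σ.IsIrreducible)
    (hσ : σ.IsSmooth) {W' : Type} [AddCommGroup W'] [Module ℂ W'] (σ' : Representation ℂ P.G W') (f : σ.IntertwiningMap σ')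
    (hinj : Function.Injective f) :
    ∃ K : Subgroup P.G, IsOpen (K : Set P.G) ∧ IsCompact (K : Set P.G) ∧ HeckeRelatedAt K σ σ' :=
  Literature.NumberTheory.Automorphic.exists_heckeRelated_of_intertwiningMap σ σ' K₀ hK₀c hK₀o hirr hσ f hinj

/-- **`SpectrumIsThetaAtLevel` FROM A THETA EMBEDDING.**  If (a) every irreducible `σ` occurring in `A` (`OccursIn P R A σ`) is smooth and (b) at `n = 3` every irreducible
smooth `σ` occurring in `A` EMBEDS into some `ω_t = rhoTriple P t` with `t` of weight one and `t.ε` global (an injective intertwiner — the shape the engine letter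
[Rogawski1990, 13.3.6 (c)] ∘ [GelbartRogawski1991, 5.1.1∕5.1.2] ∘ [Liu2021, D.1] delivers), then the spectrum of `A` is theta at finite level: §1 turns the
embedding into `HeckeRelatedAt K σ ω_t` at a compact open `K` (`P.G` has the compact open `K₀`). [cite: Liu2021, proof of Prop. 4.13 l. 2131–2146; Rem. 4.14]
[cite: BushnellHenniart2006, §4.3] -/
theorem spectrumIsThetaAtLevel_of_embeds (P : Prop413Data F₀ E₀) {X : Type} [AddCommGroup X] [Module ℂ X] (R : Representation ℂ P.G X)
    (A : Submodule ℂ X) (K₀ : Subgroup P.G) (hK₀c : IsCompact (K₀ : Set P.G)) (hK₀o : IsOpen (K₀ : Set P.G))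
    (hsm : ∀ (W : Type) [AddCommGroup W] [Module ℂ W] (σ : Representation ℂ P.G W), σ.IsIrreducible → OccursIn P R A σ → σ.IsSmooth)
    (hemb : P.n = 3 → ∀ (W : Type) [AddCommGroup W] [Module ℂ W] (σ : Representation ℂ P.G W), σ.IsIrreducible → σ.IsSmooth →
      OccursIn P R A σ → ∃ t : P.Triple, t.HasWeightOne ∧ IsGlobalEps P t.ε ∧ ∃ f : σ.IntertwiningMap (rhoTriple P t), Function.Injective f) :
    SpectrumIsThetaAtLevel P R A := by
  intro hn W _ _ σ hirr hocc
  have hσ : σ.IsSmooth := hsm W σ hirr hocc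
  obtain ⟨t, hw, hglob, f, hinj⟩ := hemb hn W σ hirr hσ hocc
  obtain ⟨K, hKo, hKc, hrel⟩ := exists_heckeRelatedAt_of_injective P K₀ hK₀c hK₀o σ hirr hσ (rhoTriple P t) f hinj
  exact ⟨K, hKo, hKc, t, hw, hglob, hrel⟩

end Generic

/-! ## §3  At the carriers of record (`adelicDatum F V`, `rightRep F V`, `cohForms 𝔞`) -/

section Carriers

variable (F : HodgeCM.CMField) {ι₁ : F →+* ℂ} (V : HodgeCM.HermSpace3 F ι₁)

/-- `U(V)(𝔸_{F⁺,f})` has a compact open subgroup: the integral level (★ `UnitaryGroup.finAdelicIntegralLevel`, `isCompact_…`, `isOpen_…`).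
[cite: PlatonovRapinchuk1994, §5.1] [cite: BorelJacquet1979, §4.1] -/
theorem exists_isCompact_isOpen_subgroup_adelicFin :
    ∃ K₀ : Subgroup ↥(HodgeCM.HermSpace3.adelicFin V), IsCompact (K₀ : Set ↥(HodgeCM.HermSpace3.adelicFin V)) ∧
      IsOpen (K₀ : Set ↥(HodgeCM.HermSpace3.adelicFin V)) :=
  ⟨UnitaryGroup.finAdelicIntegralLevel (↥(maximalRealSubfield (HodgeCM.CMField.K F))) (HodgeCM.CMField.K F)
      (IsCMField.complexConj (HodgeCM.CMField.K F)) 3 (HodgeCM.HermSpace3.Hm V),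
    UnitaryGroup.isCompact_finAdelicIntegralLevel _ _ _ _ _, UnitaryGroup.isOpen_finAdelicIntegralLevel _ _ _ _ _⟩

/-- **An irreducible `σ` of `U(V)(𝔸_{F⁺,f})` with a non-zero `rightRep`-equivariant linear map into some `A ≤ cohForms 𝔞` is SMOOTH** — the three conjuncts of
`OccursIn _ (rightRep F V) A σ` as hypotheses.  The crux carriers `rightRep F V` ∕ `cohForms 𝔞` ARE the Literature carriers `CotangentForms.rightRep` ∕ `cohForms … 𝔞.ιinf 𝔞.Kc`
by `rfl`, so this is ★ `CotangentForms.isSmooth_of_equivariant_of_le_smoothFun` with ★ `cohForms_le_smoothFun`. [cite: BorelJacquet1979, §4.2] [cite: BernsteinZelevinsky1976, §2.1] -/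
theorem isSmooth_of_equivariant_into_cohForms (𝔞 : ArchFactor F V) {W : Type} [AddCommGroup W] [Module ℂ W]
    (σ : Representation ℂ ↥(HodgeCM.HermSpace3.adelicFin V) W) (hirr : σ.IsIrreducible)
    (A : Submodule ℂ ((adelicDatum F V).Adelic → (Fin 2 → ℂ))) (hA : A ≤ cohForms 𝔞)
    (θ : W →ₗ[ℂ] ((adelicDatum F V).Adelic → (Fin 2 → ℂ))) (hθ0 : θ ≠ 0) (hθA : ∀ w, θ w ∈ A)
    (heq : ∀ (g : ↥(HodgeCM.HermSpace3.adelicFin V)) (w : W), θ (σ g w) = rightRep F V g (θ w)) : σ.IsSmooth :=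
  Literature.NumberTheory.Automorphic.UnitaryGroup.CotangentForms.isSmooth_of_equivariant_of_le_smoothFun σ hirr A
    (hA.trans (Literature.NumberTheory.Automorphic.UnitaryGroup.CotangentForms.cohForms_le_smoothFun (ιinf := 𝔞.ιinf) (Kc := 𝔞.Kc)))
    θ hθ0 hθA heq

end Carriers

/-! ## §4  THE PIN: `StubE2E2bCotPartSpectrumIsTheta` from the theta-embedding statement for cotangent parts -/

set_option synthInstance.maxHeartbeats 400000 in
set_option maxHeartbeats 8000000 in
/-- **E2E2b FROM A THETA EMBEDDING (programme P2's pin bridge, Hecke and smoothness halves discharged).**  If for every face, every automorphic `μ`, every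
realisation `ℓ` of `cohForms 𝔞₀` (`Represents`), and every discrete automorphic `Π`: at `n = 3` every IRREDUCIBLE SMOOTH `σ` of `U(V)(𝔸_{F⁺,f})` occurring in
`cotPart 𝔞₀ μ ℓ Π` EMBEDS into some `ω_t = rhoTriple (datum413 …) t` with `t` of weight one and `t.ε` global (hypothesis `hE` — the assembled content of the engine
letter (C) ★ `Rogawski1990.cohFinComponent_isTheta`, the junction J0–J3 and the line-class transport of `ω(μ, ε_a, χ)_f`), then `StubE2E2bCotPartSpectrumIsTheta`
holds: smoothness of such `σ` is PROVED (`cotPart ≤ cohForms ≤ smoothFun`, §3), and the embedding yields `HeckeRelatedAt` at a compact open level (§1–§2,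
`K₀` = the integral level). [cite: Liu2021, proof of Prop. 4.13 l. 2131–2146; Rem. 4.14; App. D Lem. D.1] [cite: Rogawski1990, Thm. 13.3.6; §15.3]
[cite: GelbartRogawski1991, Thm 5.1.1 p. 465; Lemma 5.1.2 p. 466] [cite: BushnellHenniart2006, §4.3] -/
theorem stubE2E2b_of_embeds
    (hE : ∀ (hDel : Literature.AlgebraicGeometry.ShimuraVarieties.UnitaryCanonicalModel.canonicalModel_exists_printed)
        (F : HodgeCM.CMField) [IsGalois ℚ F] (h6 : 6 ≤ Module.finrank ℚ F) {ι₁ : F →+* ℂ} (V : HodgeCM.HermSpace3 F ι₁) (a₀ : RealScalar F)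
        (Φ : CMType F) (hΦ : ι₁ ∈ Φ.1) (i : (I V (repAt a₀) (muLiu ι₁ GramClass.rep))),
      ∀ (μ : MeasureTheory.Measure (adelicDatum F V).automorphicQuotient) [(adelicDatum F V).IsAutomorphicMeasure μ]
        (ℓ : ((adelicDatum F V).Adelic → (Fin 2 → ℂ)) →ₗ[ℂ] (Fin 2 → (adelicDatum F V).L2 μ)),
        Represents F V (archFactorOf F V) μ ℓ →
          ∀ π : DiscreteAutomorphicRep (adelicDatum F V) μ,
            (datum413 hDel F V a₀ Φ i).n = 3 →
              ∀ (W : Type) [AddCommGroup W] [Module ℂ W] (σ : Representation ℂ (datum413 hDel F V a₀ Φ i).G W),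
                σ.IsIrreducible → σ.IsSmooth → OccursIn (datum413 hDel F V a₀ Φ i) (rightRep F V) (cotPart F V (archFactorOf F V) μ ℓ π) σ →
                  ∃ t : (datum413 hDel F V a₀ Φ i).Triple, t.HasWeightOne ∧ IsGlobalEps (datum413 hDel F V a₀ Φ i) t.ε ∧
                    ∃ f : σ.IntertwiningMap (rhoTriple (datum413 hDel F V a₀ Φ i) t), Function.Injective f) :
    StubE2E2bCotPartSpectrumIsTheta := by
  intro hDel F _ h6 ι₁ V a₀ Φ hΦ i μ _ ℓ hrep π
  obtain ⟨K₀, hK₀c, hK₀o⟩ := exists_isCompact_isOpen_subgroup_adelicFin F V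
  refine spectrumIsThetaAtLevel_of_embeds (datum413 hDel F V a₀ Φ i) (rightRep F V) (cotPart F V (archFactorOf F V) μ ℓ π)
    K₀ hK₀c hK₀o ?_ (hE hDel F h6 V a₀ Φ hΦ i μ ℓ hrep π)
  intro W _ _ σ hirr hocc
  obtain ⟨θ, hθ0, hθA, heq⟩ := hocc
  exact isSmooth_of_equivariant_into_cohForms F V (archFactorOf F V) σ hirr (cotPart F V (archFactorOf F V) μ ℓ π)
    (cotPart_le_cohForms F V (archFactorOf F V) μ ℓ π) θ hθ0 hθA heq

end Summit.HodgeConjecture.HodgeConjecture.Cruxes.H413.E2PinBridge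

end
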